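import Summits.QuantumFields.BalabanUV.T4Continuum.Support.ShellMeasurePlaquetteCubicAssemblyLevels

/-!
# `T4Continuum.ShellMeasurePlaquetteCubicLocated` — row S77 «S65 → S75 JUNCTION: THE LOCATED QUADRATIC MAJORANT OF THE
# (39)-SPLIT ACTION'S GRADIENT» (file 1∕2, THE LIVE LEVELS in the `WMax` currency, η-FREE kernel)
(cell `pub-balaban`, sub-cell `t4`, spine estimate NE7c (node U5b), crew lineage `b2b-balaban-t4-ne7c-formalise-leaf-02` gen 8;
owner table `LEAVES-NE7c-P1.md` row S77 — owner GO l.17266 with the η-condition, holder's say-so l.17336; imports this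
lineage's f5d-c `ShellMeasurePlaquetteCubicAssemblyLevels` (p226095) ONLY; [folklore]; 0 sorry, 0 def)

HONEST FRAMING.  Finite four-torus programme, rung (B)+1 only — NOT infinite volume, NOT a mass gap, NOT the Clay
problem, NOT summit progress; (B), `BetaPertHyp`, (B^μ) are not consumed.  NE7c (`T4IndicatorShell.ShellWeightBound`)
is NOT PRINTED and NOT PROVED; «NE7c ⇐ the named binders» (WALL `t4/b2b-balaban-t4-ne7c-p1/WALL-NE7c-P1.md` §2).
ELEMENTARY bookkeeping ([folklore]); [Balaban1985Variational] (39)∕(97)∕(98) are LOCATORS for the shape only — the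
paper is under adjudication; nothing printed is asserted or cited as a fact; no `def` is minted.
HONEST DEPENDENCY (cell): continuum YM on T⁴ ⇐ BetaPertH ∧ nine spine estimates (0/9 proved); BetaPertH ⇐ (D1) ∧ (D4)
∧ CAP+tail; G-an2-4 gates asym, D1 and NE2/3/4.

THE POINT.  Row S65 closed END-II's (P4) binder `Prop4Hyp` for OUR η-scaled one-grid action in the (Ω_j)-weighted
spaces (`prop4Hyp_locGrad_ord₃_eta_levels`: `‖W Y‖_{(−3)} ≤ C‖Y‖²_{WMax}`).  The owner's LOCALITY road (S69 → S70 → S75)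
reads END-II in PINNED norms and its bridge `ShellMeasurePinnedProp4.prop4Hyp_pinned` wants MORE than a global quadratic
bound: a LOCATED QUADRATIC MAJORANT `‖W A c‖ ≤ ‖A‖·Σ_b k c b·‖A b‖` whose kernel `k c b` sees only the bonds near `c`.
Both halves of S65's gradient ARE located — f2b's per-plaquette Cauchy bound reads the field only on `∂p`, leaf-05's f3d
reads it only on `nbhdSites`∕`baseSites` — so the located majorant is a re-bookkeeping of S65, done here in the `WMax`
currency so that the kernel is η-FREE at the live levels (owner's condition, l.17266):
* §1 (generic, f2b's data) **`weighted_locGrad_le_located`**: `(w c)³‖locGrad (Σ_p φ_p) A c‖ ≤ 8κLc⁴·s·Σ_{p∋c} Σ_{b∈supp p} w b‖A b‖`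
  for `w b‖A b‖ ≤ s`, `2s < ε` (the per-plaquette local size `s_p = max_{∂p} w b‖A b‖` replaces one factor `s`);
  `sum_filter_sum_eq_sum_card` (the kernel form `Σ_b #{p : c, b ∈ supp p}·g b`);
* §2 **`weighted_locGrad_cubT_le_located`**: `(wt c)³‖locGrad (cubT Λ Pl w τ η U₀) A c‖ ≤
  144(d−1)‖w‖‖τ‖Lc³·|Dv A|_{(−2)}·Σ_{b : b.1.1 ∈ nbhdSites c} wt b‖A b‖` (f3d with the local field size `Σ_{N(c)}‖A b‖`, the
  floor `Wf c ≤ wt b` on `N(c)`, the ∇-size through the ∇-datum globally);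
* §3 **`located_quad_ord₃_eta_levels`** — THE S77 END: under f5d-c's hypotheses verbatim, for `Y : WMax wt wd Dv` with
  `‖Y‖ < ε∕2` and every bond `c`:
  `(wt c)³·‖locGrad (etaScale η (Σ_{p∈Pl} ord₃ (plaqFunSym τ U (bd p)))) Y c‖ ≤
     ‖Y‖·(72(d−1)‖τ‖Lc³·Σ_{b : b.1.1 ∈ nbhdSites c} wt b‖Y b‖ + 8κLc⁴·Σ_{p∋c} Σ_{b∈∂p} wt b‖Y b‖)`, `κ = ‖τ‖(248∕3·ε₀ + 40∕3·ε)`,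
  and its KERNEL FORM **`located_quad_ord₃_eta_levels_kernel`**: `≤ ‖Y‖·Σ_b k c b·(wt b‖Y b‖)` with the η-FREE located kernel
  `k c b = 72(d−1)‖τ‖Lc³·[b.1.1 ∈ nbhdSites c.1.1 c.1.2] + 8κLc⁴·#{p ∈ Pl : c ∈ bonds (bd p) ∧ b ∈ bonds (bd p)}` — the input
  of the owner's announced S75 f2 `prop4Hyp_pinned_weighted` (pin on the field component of `WMax`).
File 2∕2 (`…LocatedPinned`): the LEVEL-0 flat instance `‖W A c‖ ≤ ‖A‖·Σ_b k₀ c b‖A b‖` and S75's `prop4Hyp_pinned` FIRED on it.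
NOT HERE: the pin geometry `(ρ, pos, ϖ, δ′)` and the row sums `Σ_b k c b·e^{δ′ρ} ≤ M` (displayed data of S75∕[dict]);
no estimate of Bałaban's at a live level is discharged.
-/

noncomputable section

open scoped BigOperators

namespace Summit.QuantumFields.BalabanUV.T4Continuum.ShellMeasurePlaquetteCubicLocated

open Literature.MathematicalPhysics.QuantumFieldTheory.Balaban1983to89
open B7Prop1Explicit (e U1 mem_U1)
open B8Ineq132 (covDerivFwd)
open ShellMeasureWilsonGradientTail (plaqWord bonds)
open ShellMeasurePlaquetteTwist (plaqFunSym)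
open ShellMeasureLocalGradientTailJet (ord₃)
open Summit.QuantumFields.BalabanUV.T4Continuum.ShellMeasureCommutatorVariation (plaqStar)
open Summit.QuantumFields.BalabanUV.T4Continuum.ShellMeasureCommutatorGradientLocal
  (baseSites nbhdSites norm_sum_dcub_bump_le_local)
open Summit.QuantumFields.BalabanUV.T4Continuum.ShellMeasureCommutatorLocGrad (ext ext_apply_of_mem ext_apply_of_not_mem cubT)
open Summit.QuantumFields.BalabanUV.T4Continuum.ShellMeasureLocalGradientTail (locGrad sgl locGrad_sum_eq_filter)
open Summit.QuantumFields.BalabanUV.T4Continuum.ShellMeasureGradientTailLevels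
  (isOpen_polydisc mem_polydisc_of_wBall norm_fderiv_comp_sgl_le_weighted_sq)
open Summit.QuantumFields.BalabanUV.T4Continuum.ShellMeasureMultiGridNorms
open Summit.QuantumFields.BalabanUV.T4Continuum.ShellMeasureMultiGridNormsMax
open Summit.QuantumFields.BalabanUV.T4Continuum.ShellMeasurePlaquetteCubicDictionary (V0remCov)
open Summit.QuantumFields.BalabanUV.T4Continuum.ShellMeasurePlaquetteCubicCovBinders (analyticAt_V0remCov V0remCov_add_single)
open Summit.QuantumFields.BalabanUV.T4Continuum.ShellMeasureWilsonRemainderLevels (etaScale analyticAt_etaScale etaScale_add_single)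
open Summit.QuantumFields.BalabanUV.T4Continuum.ShellMeasureWilsonRemainderLevelsCov (hcub_V0remCov_eta)
open Summit.QuantumFields.BalabanUV.T4Continuum.ShellMeasurePlaquetteCubicAssembly (restr_unit_bounded)
open Summit.QuantumFields.BalabanUV.T4Continuum.ShellMeasurePlaquetteCubicAssemblyLevels (locGrad_etaScale_sum_ord₃_eq)

export B7Prop1Explicit (Site)

/-! ## §1 The located (97) for a local family (f2b's data) -/

section Generic

variable {Λ : Type*} [Fintype Λ] [DecidableEq Λ] {𝔄 : Type*} [NormedAddCommGroup 𝔄] [NormedSpace ℂ 𝔄]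
  {P : Type*} (Pl : Finset P) (φ : P → (Λ → 𝔄) → ℂ) (supp : P → Finset Λ) (w : Λ → ℝ) (W : P → ℝ)

omit [Fintype Λ] [NormedSpace ℂ 𝔄] in
/-- THE KERNEL FORM of a located double sum: `Σ_{p ∈ Pl, c ∈ supp p} Σ_{b ∈ supp p} g b = Σ_b #{p ∈ Pl : c, b ∈ supp p}·g b`.
[folklore] -/
theorem sum_filter_sum_eq_sum_card [Fintype Λ] (c : Λ) (g : Λ → ℝ) :
    ∑ p ∈ Pl.filter (fun p => c ∈ supp p), ∑ b ∈ supp p, g b =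
      ∑ b, ((Pl.filter (fun p => c ∈ supp p ∧ b ∈ supp p)).card : ℝ) * g b := by
  have h1 : ∀ p ∈ Pl.filter (fun p => c ∈ supp p),
      ∑ b ∈ supp p, g b = ∑ b, if b ∈ supp p then g b else 0 := fun p _ => by
    rw [← Finset.sum_filter]
    congr 1
    ext b
    simp
  rw [Finset.sum_congr rfl h1, Finset.sum_comm]
  refine Finset.sum_congr rfl fun b _ => ?_
  rw [← Finset.sum_filter, Finset.sum_const, nsmul_eq_mul, Finset.filter_filter]

/-- **THE LOCATED (97) FOR THE `∇`-FREE PLAQUETTE PART.**  f2b's data (weights `W p ≤ w b ≤ Lc·W p` on `supp p`,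
`1 ≤ Lc`; every `φ_p` local to `supp p`, ℂ-differentiable on the weighted polydisc with the (40)-shape cubic binder
`κ∕W p`); for a field with `w b·‖A b‖ ≤ s` for all `b`, `2s < ε`, and EVERY bond `c`:
`(w c)³·‖locGrad (Σ_p φ_p) A c‖ ≤ 8κLc⁴·s·Σ_{p∈Pl, c∈supp p} Σ_{b∈supp p} w b‖A b‖` — ONE factor `s` of
`weighted_locGrad_le` is replaced by the LOCAL size of the field on the plaquettes through `c`. [folklore] -/
theorem weighted_locGrad_le_located {ε κ Lc s : ℝ} (hκ : 0 ≤ κ) (hLc1 : 1 ≤ Lc)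
    (hw : ∀ b, 0 < w b) (hW : ∀ p ∈ Pl, 0 < W p)
    (hWw : ∀ p ∈ Pl, ∀ b ∈ supp p, W p ≤ w b) (hwW : ∀ p ∈ Pl, ∀ b ∈ supp p, w b ≤ Lc * W p)
    (hd : ∀ p ∈ Pl, DifferentiableOn ℂ (φ p) {A : Λ → 𝔄 | ∀ b' ∈ supp p, ‖A b'‖ < ε / W p})
    (hcub : ∀ p ∈ Pl, ∀ (A : Λ → 𝔄) (σ : ℝ), 0 ≤ σ → σ < ε / W p → (∀ b' ∈ supp p, ‖A b'‖ ≤ σ) →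
      ‖φ p A‖ ≤ κ / W p * σ ^ 3)
    (hloc : ∀ p ∈ Pl, ∀ A : Λ → 𝔄, ∀ b ∉ supp p, ∀ X : 𝔄, φ p (A + Pi.single b X) = φ p A)
    {A : Λ → 𝔄} (hs : 0 ≤ s) (hA : ∀ b, w b * ‖A b‖ ≤ s) (h2s : 2 * s < ε) (c : Λ) :
    w c ^ 3 * ‖locGrad (fun A => ∑ p ∈ Pl, φ p A) A c‖ ≤
      8 * κ * Lc ^ 4 * s * ∑ p ∈ Pl.filter (fun p => c ∈ supp p), ∑ b ∈ supp p, w b * ‖A b‖ := by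
  have hwc : 0 < w c := hw c
  have hLc0 : 0 ≤ Lc := zero_le_one.trans hLc1
  -- `A` lies in every polydisc, so every `φ_p` is differentiable at `A`
  have hAlt : ∀ b', w b' * ‖A b'‖ < ε := fun b' => (hA b').trans_lt (by linarith)
  have hφA : ∀ p ∈ Pl, DifferentiableAt ℂ (φ p) A := fun p hp =>
    (hd p hp).differentiableAt ((isOpen_polydisc (supp p) _).mem_nhds
      (mem_polydisc_of_wBall supp w W hAlt (hW p hp) (hWw p hp)))
  rw [locGrad_sum_eq_filter Pl φ supp hφA hloc c]
  -- each plaquette through `c` contributes `≤ 8κLc⁴·s·(local size)/(w c)³`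
  have hterm : ∀ p ∈ Pl.filter (fun p => c ∈ supp p),
      w c ^ 3 * ‖(fderiv ℂ (φ p) A).comp (sgl c)‖ ≤ 8 * κ * Lc ^ 4 * s * ∑ b ∈ supp p, w b * ‖A b‖ := by
    intro p hp
    rw [Finset.mem_filter] at hp
    obtain ⟨hp, hc⟩ := hp
    -- the bond of `supp p` where the weighted field is largest
    obtain ⟨b₀, hb₀, hmax⟩ := Finset.exists_max_image (supp p) (fun b => w b * ‖A b‖) ⟨c, hc⟩
    have hsp0 : 0 ≤ w b₀ * ‖A b₀‖ := mul_nonneg (hw b₀).le (norm_nonneg _)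
    have hsps : w b₀ * ‖A b₀‖ ≤ s := hA b₀
    have hAp : ∀ b' ∈ supp p, ‖A b'‖ ≤ w b₀ * ‖A b₀‖ / W p := by
      intro b' hb'
      rw [le_div_iff₀ (hW p hp)]
      calc ‖A b'‖ * W p ≤ ‖A b'‖ * w b' := mul_le_mul_of_nonneg_left (hWw p hp b' hb') (norm_nonneg _)
        _ = w b' * ‖A b'‖ := mul_comm _ _
        _ ≤ w b₀ * ‖A b₀‖ := hmax b' hb'
    have h1 : w c ^ 3 * ‖(fderiv ℂ (φ p) A).comp (sgl c)‖ ≤ 8 * κ * Lc ^ 4 * (w b₀ * ‖A b₀‖) ^ 2 :=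
      norm_fderiv_comp_sgl_le_weighted_sq (b := c) (hW p hp) hκ hLc1 (hd p hp) (hcub p hp) (hWw p hp c hc)
        (hwW p hp c hc) hsp0 hAp (by linarith)
    have hle : w b₀ * ‖A b₀‖ ≤ ∑ b ∈ supp p, w b * ‖A b‖ :=
      Finset.single_le_sum (fun b _ => mul_nonneg (hw b).le (norm_nonneg _)) hb₀
    calc w c ^ 3 * ‖(fderiv ℂ (φ p) A).comp (sgl c)‖ ≤ 8 * κ * Lc ^ 4 * (w b₀ * ‖A b₀‖) ^ 2 := h1
      _ = 8 * κ * Lc ^ 4 * (w b₀ * ‖A b₀‖) * (w b₀ * ‖A b₀‖) := by ring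
      _ ≤ 8 * κ * Lc ^ 4 * s * ∑ b ∈ supp p, w b * ‖A b‖ := by gcongr
  calc w c ^ 3 * ‖∑ p ∈ Pl.filter (fun p => c ∈ supp p), (fderiv ℂ (φ p) A).comp (sgl c)‖
      ≤ w c ^ 3 * ∑ p ∈ Pl.filter (fun p => c ∈ supp p), ‖(fderiv ℂ (φ p) A).comp (sgl c)‖ :=
        mul_le_mul_of_nonneg_left (norm_sum_le _ _) (pow_nonneg hwc.le 3)
    _ = ∑ p ∈ Pl.filter (fun p => c ∈ supp p), w c ^ 3 * ‖(fderiv ℂ (φ p) A).comp (sgl c)‖ := Finset.mul_sum _ _ _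
    _ ≤ ∑ p ∈ Pl.filter (fun p => c ∈ supp p), 8 * κ * Lc ^ 4 * s * ∑ b ∈ supp p, w b * ‖A b‖ :=
        Finset.sum_le_sum hterm
    _ = 8 * κ * Lc ^ 4 * s * ∑ p ∈ Pl.filter (fun p => c ∈ supp p), ∑ b ∈ supp p, w b * ‖A b‖ :=
        (Finset.mul_sum _ _ _).symm

end Generic

/-! ## §2 The located bound of the `∇`-part, weighted -/

section Grad

variable {d : ℕ} {𝔸 : Type*} [NormedRing 𝔸] [NormOneClass 𝔸] [NormedAlgebra ℂ 𝔸]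
  (Λ : Finset (Site d × Fin d)) (Pl : Finset (Fin d × Fin d × Site d)) (w : ℂ) {τ : 𝔸 →L[ℂ] ℂ}
  (wt : ↥Λ → ℝ) [hwt : Fact (∀ b, 0 < wt b)] {I : Type*} [Fintype I] (wd : I → ℝ) [hwd : Fact (∀ i, 0 < wd i)]
  (Dv : (↥Λ → 𝔸) →L[ℂ] (I → 𝔸)) (Wf Wd : ↥Λ → ℝ)

omit [NormOneClass 𝔸] [NormedAlgebra ℂ 𝔸] hwt in
/-- THE LOCAL FIELD SIZE as a located sum: on the sites of `nbhdSites c` the extended field is bounded by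
`Σ_{b : b.1.1 ∈ nbhdSites c} ‖A b‖`. [folklore] -/
theorem norm_ext_le_sum_nbhd (A : ↥Λ → 𝔸) (c : ↥Λ) {x : Site d} (hx : x ∈ nbhdSites c.1.1 c.1.2) (μ : Fin d) :
    ‖ext Λ A x μ‖ ≤ ∑ b ∈ Finset.univ.filter (fun b : ↥Λ => b.1.1 ∈ nbhdSites c.1.1 c.1.2), ‖A b‖ := by
  by_cases h : (x, μ) ∈ Λ
  · rw [ext_apply_of_mem Λ A h]
    exact Finset.single_le_sum (f := fun b : ↥Λ => ‖A b‖) (fun b _ => norm_nonneg _)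
      (Finset.mem_filter.2 ⟨Finset.mem_univ _, hx⟩)
  · rw [ext_apply_of_not_mem Λ A h, norm_zero]
    exact Finset.sum_nonneg fun b _ => norm_nonneg _

/-- **THE LOCATED BOUND OF THE `∇`-PART, WEIGHTED.**  For a bond `c` of `Λ` whose star lies in the increasing plaquette
set `Pl`, with the local floors `Wf c ≤ wt b` on `nbhdSites c`, `Wd c` (∇-datum domination on `baseSites c`), and
the bond's weight within the scale jump (`wt c ≤ Lc·Wf c`, `wt c ≤ Lc·Wd c`, `1 ≤ Lc`):
`(wt c)³·‖locGrad (cubT …) A c‖ ≤ 144(d−1)·‖w‖·‖τ‖·Lc³·|Dv A|_{(−2)}·Σ_{b : b.1.1 ∈ nbhdSites c} wt b·‖A b‖` — leaf-05's f3d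
with the field read ONLY near `c` (located) and the derivative size through the ∇-datum (global). [folklore] -/
theorem weighted_locGrad_cubT_le_located {η : ℝ} (hη : 0 < η) {U₀ : Site d → Fin d → 𝔸ˣ} (h₀ : ∀ y κ, U₀ y κ ∈ U1 𝔸)
    (htr : ∀ P Q : 𝔸, τ (P * Q) = τ (Q * P)) (hincr : ∀ p ∈ Pl, p.1 < p.2.1)
    {c : ↥Λ} (hst : plaqStar c.1.1 c.1.2 ⊆ Pl) {Lc : ℝ} (hLc : 1 ≤ Lc) (hWd0 : 0 < Wd c)
    (hWf : ∀ b' : ↥Λ, b'.1.1 ∈ nbhdSites c.1.1 c.1.2 → Wf c ≤ wt b')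
    (hcf : wt c ≤ Lc * Wf c) (hcd : wt c ≤ Lc * Wd c)
    (hDv : ∀ (A : ↥Λ → 𝔸) (x : Site d) (κ' τ' : Fin d), x ∈ baseSites c.1.1 →
      Wd c ^ 2 * ‖covDerivFwd η U₀ κ' (fun z => ext Λ A z τ') x‖ ≤ ‖(WSup.toPiL wd 2).symm (Dv A)‖)
    (A : ↥Λ → 𝔸) :
    wt c ^ 3 * ‖locGrad (cubT Λ Pl w τ η U₀) A c‖ ≤
      144 * ((d : ℝ) - 1) * ‖w‖ * ‖τ‖ * Lc ^ 3 * ‖(WSup.toPiL wd 2).symm (Dv A)‖ *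
        ∑ b ∈ Finset.univ.filter (fun b : ↥Λ => b.1.1 ∈ nbhdSites c.1.1 c.1.2), wt b * ‖A b‖ := by
  have hd : 0 ≤ (d : ℝ) - 1 := by
    have : 1 ≤ d := Nat.succ_le_of_lt (Fin.pos c.1.2)
    have : (1 : ℝ) ≤ d := by exact_mod_cast this
    linarith
  set a := ∑ b ∈ Finset.univ.filter (fun b : ↥Λ => b.1.1 ∈ nbhdSites c.1.1 c.1.2), ‖A b‖ with ha_def
  set N := ‖(WSup.toPiL wd 2).symm (Dv A)‖ with hN_def
  have ha0 : 0 ≤ a := Finset.sum_nonneg fun b _ => norm_nonneg _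
  have hN0 : 0 ≤ N := norm_nonneg _
  have hB : ∀ (x : Site d) (μ : Fin d), x ∈ nbhdSites c.1.1 c.1.2 → ‖ext Λ A x μ‖ ≤ a :=
    fun x μ hx => norm_ext_le_sum_nbhd Λ A c hx μ
  have hG : ∀ (x : Site d) (κ' τ' : Fin d), x ∈ baseSites c.1.1 →
      ‖covDerivFwd η U₀ κ' (fun z => ext Λ A z τ') x‖ ≤ N / Wd c ^ 2 := by
    intro x κ' τ' hx
    rw [le_div_iff₀ (pow_pos hWd0 2), mul_comm]
    exact hDv A x κ' τ' hx
  have hK : 0 ≤ 144 * ((d : ℝ) - 1) * ‖w‖ * ‖τ‖ := by positivity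
  -- the flat located bound
  have hflat : ‖locGrad (cubT Λ Pl w τ η U₀) A c‖ ≤ 144 * ((d : ℝ) - 1) * ‖w‖ * ‖τ‖ * a * (N / Wd c ^ 2) := by
    refine ShellMeasureCommutatorLocGrad.norm_locGrad_cubT_le Λ Pl w τ η U₀ A c (by positivity) fun X => ?_
    exact norm_sum_dcub_bump_le_local hη h₀ hB hG w htr hst hincr X
  -- the weights: `wt c·a ≤ Lc·Σ wt b‖A b‖` (floor) and `wt c² ≤ Lc²·Wd c²`
  have hfloor : Wf c * a ≤ ∑ b ∈ Finset.univ.filter (fun b : ↥Λ => b.1.1 ∈ nbhdSites c.1.1 c.1.2), wt b * ‖A b‖ := by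
    rw [ha_def, Finset.mul_sum]
    refine Finset.sum_le_sum fun b hb => ?_
    exact mul_le_mul_of_nonneg_right (hWf b (Finset.mem_filter.1 hb).2) (norm_nonneg _)
  set S := ∑ b ∈ Finset.univ.filter (fun b : ↥Λ => b.1.1 ∈ nbhdSites c.1.1 c.1.2), wt b * ‖A b‖ with hS_def
  have hwt0 : 0 ≤ wt c := (hwt.out c).le
  have h1 : wt c * a ≤ Lc * S := by
    calc wt c * a ≤ Lc * Wf c * a := mul_le_mul_of_nonneg_right hcf ha0
      _ = Lc * (Wf c * a) := by ring
      _ ≤ Lc * S := mul_le_mul_of_nonneg_left hfloor (zero_le_one.trans hLc)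
  have h2 : wt c ^ 2 * (N / Wd c ^ 2) ≤ Lc ^ 2 * N := by
    have hsq : wt c ^ 2 ≤ (Lc * Wd c) ^ 2 := pow_le_pow_left₀ hwt0 hcd 2
    rw [mul_div_assoc', div_le_iff₀ (pow_pos hWd0 2)]
    calc wt c ^ 2 * N ≤ (Lc * Wd c) ^ 2 * N := mul_le_mul_of_nonneg_right hsq hN0
      _ = Lc ^ 2 * N * Wd c ^ 2 := by ring
  calc wt c ^ 3 * ‖locGrad (cubT Λ Pl w τ η U₀) A c‖
      ≤ wt c ^ 3 * (144 * ((d : ℝ) - 1) * ‖w‖ * ‖τ‖ * a * (N / Wd c ^ 2)) :=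
        mul_le_mul_of_nonneg_left hflat (pow_nonneg hwt0 3)
    _ = 144 * ((d : ℝ) - 1) * ‖w‖ * ‖τ‖ * (wt c * a) * (wt c ^ 2 * (N / Wd c ^ 2)) := by ring
    _ ≤ 144 * ((d : ℝ) - 1) * ‖w‖ * ‖τ‖ * (Lc * S) * (Lc ^ 2 * N) := by
        have hS0 : 0 ≤ Lc * S := (mul_nonneg hwt0 ha0).trans h1
        gcongr
    _ = 144 * ((d : ℝ) - 1) * ‖w‖ * ‖τ‖ * Lc ^ 3 * N * S := by ring

end Grad

/-! ## §3 The located quadratic majorant of the η-scaled action's gradient at the live levels (η-free kernel) -/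

section Levels

variable {d : ℕ} {𝔸 : Type*} [NormedRing 𝔸] [NormOneClass 𝔸] [NormedAlgebra ℂ 𝔸] [CompleteSpace 𝔸]
  (Λ : Finset (Site d × Fin d)) (Pl : Finset (Fin d × Fin d × Site d)) (τ : 𝔸 →L[ℂ] ℂ)
  {U₀ : Site d → Fin d → 𝔸ˣ} (h₀ : ∀ y κ, U₀ y κ ∈ U1 𝔸) (bd : Fin d × Fin d × Site d → (Fin 4 → ↥Λ × Bool))
  (wt : ↥Λ → ℝ) [hwt : Fact (∀ b, 0 < wt b)] {I : Type*} [Fintype I] (wd : I → ℝ) [hwd : Fact (∀ i, 0 < wd i)]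
  (Dv : (↥Λ → 𝔸) →L[ℂ] (I → 𝔸)) (Wf Wd : ↥Λ → ℝ) (W : Fin d × Fin d × Site d → ℝ)
include h₀

/-- **THE LOCATED QUADRATIC MAJORANT AT THE LIVE LEVELS (row S77's END, two-sum form).**  Under the hypotheses of f5d-c's
`prop4Hyp_locGrad_ord₃_eta_levels` verbatim, for every `Y : WMax wt wd Dv` with `‖Y‖ < ε∕2` and every bond `c`:
`(wt c)³·‖locGrad (etaScale η (Σ_{p∈Pl} ord₃ (plaqFunSym τ U (bd p)))) Y c‖ ≤
   ‖Y‖·(72(d−1)‖τ‖Lc³·Σ_{b : b.1.1 ∈ nbhdSites c} wt b‖Y b‖ + 8κLc⁴·Σ_{p∈Pl, c∈∂p} Σ_{b∈∂p} wt b‖Y b‖)`,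
`κ = ‖τ‖(248∕3·ε₀ + 40∕3·ε)` — GLOBAL factor `‖Y‖_WMax`, LOCATED factor the weighted field size near `c`, constants η-FREE.
[Balaban1985Variational] (97)∕(98) TYPE in located form; nothing printed is asserted. [folklore] -/
theorem located_quad_ord₃_eta_levels {η : ℝ} (hη : 0 < η) (htr : ∀ P Q : 𝔸, τ (P * Q) = τ (Q * P))
    (hincr : ∀ p ∈ Pl, p.1 < p.2.1) (hst : ∀ b : ↥Λ, plaqStar b.1.1 b.1.2 ⊆ Pl)
    (hbd : ∀ p ∈ Pl, ((bd p 0).1 : Site d × Fin d) = (p.2.2, p.1) ∧ ((bd p 1).1 : Site d × Fin d) = (p.2.2 + e p.1, p.2.1)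
      ∧ ((bd p 2).1 : Site d × Fin d) = (p.2.2 + e p.2.1, p.1) ∧ ((bd p 3).1 : Site d × Fin d) = (p.2.2, p.2.1))
    (hor : ∀ p ∈ Pl, (bd p 0).2 = true ∧ (bd p 1).2 = true ∧ (bd p 2).2 = false ∧ (bd p 3).2 = false)
    {Lc : ℝ} (hLc : 1 ≤ Lc) (hWd0 : ∀ b, 0 < Wd b)
    (hWf : ∀ b b' : ↥Λ, b'.1.1 ∈ nbhdSites b.1.1 b.1.2 → Wf b ≤ wt b')
    (hcf : ∀ b, wt b ≤ Lc * Wf b) (hcd : ∀ b, wt b ≤ Lc * Wd b)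
    (hDv : ∀ (A : ↥Λ → 𝔸) (b : ↥Λ) (x : Site d) (κ' τ' : Fin d), x ∈ baseSites b.1.1 →
      Wd b ^ 2 * ‖covDerivFwd η U₀ κ' (fun z => ext Λ A z τ') x‖ ≤ ‖(WSup.toPiL wd 2).symm (Dv A)‖)
    {ε ε₀ : ℝ} (hε : 0 < ε) (hε₀ : 0 ≤ ε₀) (hε4 : 4 * ε ≤ 1) (hηW : ∀ p ∈ Pl, η ≤ W p)
    (hWw : ∀ p ∈ Pl, ∀ b ∈ bonds (bd p), W p ≤ wt b) (hwW : ∀ p ∈ Pl, ∀ b ∈ bonds (bd p), wt b ≤ Lc * W p)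
    (hreg : ∀ p ∈ Pl, ‖(plaqWord (fun b : ↥Λ => U₀ b.1.1 b.1.2) (bd p) (0 : ↥Λ → 𝔸) : 𝔸) - 1‖ ≤ ε₀ * (η / W p) ^ 2)
    (Y : WMax wt wd Dv) (hY : ‖Y‖ < ε / 2) (c : ↥Λ) :
    wt c ^ 3 * ‖locGrad (etaScale η (fun A : ↥Λ → 𝔸 =>
          ∑ p ∈ Pl, ord₃ (plaqFunSym τ (fun b : ↥Λ => U₀ b.1.1 b.1.2) (bd p)) A)) (WMax.toPiL wt wd Dv Y) c‖ ≤
      ‖Y‖ * (72 * ((d : ℝ) - 1) * ‖τ‖ * Lc ^ 3 *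
          ∑ b ∈ Finset.univ.filter (fun b : ↥Λ => b.1.1 ∈ nbhdSites c.1.1 c.1.2), wt b * ‖Y b‖
        + 8 * (‖τ‖ * (248 / 3 * ε₀ + 40 / 3 * ε)) * Lc ^ 4 *
          ∑ p ∈ Pl.filter (fun p => c ∈ bonds (bd p)), ∑ b ∈ bonds (bd p), wt b * ‖Y b‖) := by
  obtain ⟨hU, hU'⟩ := restr_unit_bounded Λ h₀
  have hY0 : 0 ≤ ‖Y‖ := norm_nonneg _
  -- the flat field and its two sizes
  have hA1 : ∀ b, wt b * ‖Y b‖ ≤ ‖Y‖ := fun b => by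
    have h := WSup.norm_apply_le wt 1 (WMax.toWSupL wt wd Dv Y) b
    rw [pow_one] at h
    exact h.trans (WMax.norm_wsup_le wt wd Dv Y)
  have hA2 : ‖(WSup.toPiL wd 2).symm (Dv (WMax.toPiL wt wd Dv Y))‖ ≤ ‖Y‖ := WMax.norm_deriv_le wt wd Dv Y
  -- split the gradient
  rw [locGrad_etaScale_sum_ord₃_eq Λ Pl τ h₀ bd htr hη.ne' hbd, Pi.add_apply]
  -- the `∇`-part at the η-free weight `i∕2`
  have hgrad := weighted_locGrad_cubT_le_located Λ Pl (Complex.I / 2) wt wd Dv Wf Wd hη h₀ htr hincr (hst c) hLc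
    (hWd0 c) (hWf c) (hcf c) (hcd c) (fun A x κ' τ' hx => hDv A c x κ' τ' hx) (WMax.toPiL wt wd Dv Y)
  rw [ShellMeasurePlaquetteCubicAssemblyLevels.norm_I_div_two] at hgrad
  -- the `∇`-free part: §1 FIRED on `φ p := etaScale η (V0remCov τ U (bd p))`
  have hκ : 0 ≤ ‖τ‖ * (248 / 3 * ε₀ + 40 / 3 * ε) := by positivity
  have hWpos : ∀ p ∈ Pl, 0 < W p := fun p hp => hη.trans_le (hηW p hp)
  have hfree := weighted_locGrad_le_located Pl (fun p => etaScale η (V0remCov τ (fun b : ↥Λ => U₀ b.1.1 b.1.2) (bd p)))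
    (fun p => bonds (bd p)) wt W hκ hLc (fun b => hwt.out b) hWpos hWw hwW
    (fun p _ => ((ShellMeasureWilsonRemainderLevels.analyticOnNhd_etaScale
      (analyticAt_V0remCov τ (bd p) hU hU') η _).differentiableOn))
    (fun p hp => hcub_V0remCov_eta τ hU hU' (bd p) (hor p hp).1 (hor p hp).2.1 (hor p hp).2.2.1 (hor p hp).2.2.2 hη
      (hηW p hp) hε₀ (hreg p hp) hε4)
    (fun p _ A b hb X => etaScale_add_single (fun A b hb X => V0remCov_add_single τ (bd p) hU hU' A hb X) η A hb X)
    hY0 hA1 (by linarith) c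
  -- assemble
  have hK1 : 0 ≤ 144 * ((d : ℝ) - 1) * (1 / 2) * ‖τ‖ * Lc ^ 3 := by
    have hd : 0 ≤ (d : ℝ) - 1 := by
      have : 1 ≤ d := Nat.succ_le_of_lt (Fin.pos c.1.2)
      have : (1 : ℝ) ≤ d := by exact_mod_cast this
      linarith
    have : 0 ≤ Lc := zero_le_one.trans hLc
    positivity
  have hS1 : 0 ≤ ∑ b ∈ Finset.univ.filter (fun b : ↥Λ => b.1.1 ∈ nbhdSites c.1.1 c.1.2), wt b * ‖Y b‖ :=
    Finset.sum_nonneg fun b _ => mul_nonneg (hwt.out b).le (norm_nonneg _)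
  have hwt3 : 0 ≤ wt c ^ 3 := pow_nonneg (hwt.out c).le 3
  calc wt c ^ 3 * ‖locGrad (cubT Λ Pl (Complex.I / 2) τ η U₀) (WMax.toPiL wt wd Dv Y) c
        + locGrad (fun A => ∑ p ∈ Pl, etaScale η (V0remCov τ (fun b : ↥Λ => U₀ b.1.1 b.1.2) (bd p)) A)
          (WMax.toPiL wt wd Dv Y) c‖
      ≤ wt c ^ 3 * ‖locGrad (cubT Λ Pl (Complex.I / 2) τ η U₀) (WMax.toPiL wt wd Dv Y) c‖
        + wt c ^ 3 * ‖locGrad (fun A => ∑ p ∈ Pl, etaScale η (V0remCov τ (fun b : ↥Λ => U₀ b.1.1 b.1.2) (bd p)) A)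
          (WMax.toPiL wt wd Dv Y) c‖ := by
        rw [← mul_add]
        exact mul_le_mul_of_nonneg_left (norm_add_le _ _) hwt3
    _ ≤ 144 * ((d : ℝ) - 1) * (1 / 2) * ‖τ‖ * Lc ^ 3 * ‖Y‖ *
          ∑ b ∈ Finset.univ.filter (fun b : ↥Λ => b.1.1 ∈ nbhdSites c.1.1 c.1.2), wt b * ‖Y b‖
        + 8 * (‖τ‖ * (248 / 3 * ε₀ + 40 / 3 * ε)) * Lc ^ 4 * ‖Y‖ *
          ∑ p ∈ Pl.filter (fun p => c ∈ bonds (bd p)), ∑ b ∈ bonds (bd p), wt b * ‖Y b‖ := by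
        refine add_le_add (hgrad.trans ?_) hfree
        exact mul_le_mul_of_nonneg_right (mul_le_mul_of_nonneg_left hA2 hK1) hS1
    _ = _ := by ring

/-- **THE KERNEL FORM (row S77's END as the owner's S75 f2 will consume it).**  Same hypotheses; with the η-FREE located
kernel `k c b = 72(d−1)‖τ‖Lc³·[b.1.1 ∈ nbhdSites c.1.1 c.1.2] + 8κLc⁴·#{p ∈ Pl : c ∈ bonds (bd p) ∧ b ∈ bonds (bd p)}`:
`(wt c)³·‖locGrad (etaScale η (Σ_p ord₃ plaqFunSym_p)) Y c‖ ≤ ‖Y‖·Σ_b k c b·(wt b·‖Y b‖)` on `‖Y‖ < ε∕2`. [folklore] -/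
theorem located_quad_ord₃_eta_levels_kernel {η : ℝ} (hη : 0 < η) (htr : ∀ P Q : 𝔸, τ (P * Q) = τ (Q * P))
    (hincr : ∀ p ∈ Pl, p.1 < p.2.1) (hst : ∀ b : ↥Λ, plaqStar b.1.1 b.1.2 ⊆ Pl)
    (hbd : ∀ p ∈ Pl, ((bd p 0).1 : Site d × Fin d) = (p.2.2, p.1) ∧ ((bd p 1).1 : Site d × Fin d) = (p.2.2 + e p.1, p.2.1)
      ∧ ((bd p 2).1 : Site d × Fin d) = (p.2.2 + e p.2.1, p.1) ∧ ((bd p 3).1 : Site d × Fin d) = (p.2.2, p.2.1))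
    (hor : ∀ p ∈ Pl, (bd p 0).2 = true ∧ (bd p 1).2 = true ∧ (bd p 2).2 = false ∧ (bd p 3).2 = false)
    {Lc : ℝ} (hLc : 1 ≤ Lc) (hWd0 : ∀ b, 0 < Wd b)
    (hWf : ∀ b b' : ↥Λ, b'.1.1 ∈ nbhdSites b.1.1 b.1.2 → Wf b ≤ wt b')
    (hcf : ∀ b, wt b ≤ Lc * Wf b) (hcd : ∀ b, wt b ≤ Lc * Wd b)
    (hDv : ∀ (A : ↥Λ → 𝔸) (b : ↥Λ) (x : Site d) (κ' τ' : Fin d), x ∈ baseSites b.1.1 →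
      Wd b ^ 2 * ‖covDerivFwd η U₀ κ' (fun z => ext Λ A z τ') x‖ ≤ ‖(WSup.toPiL wd 2).symm (Dv A)‖)
    {ε ε₀ : ℝ} (hε : 0 < ε) (hε₀ : 0 ≤ ε₀) (hε4 : 4 * ε ≤ 1) (hηW : ∀ p ∈ Pl, η ≤ W p)
    (hWw : ∀ p ∈ Pl, ∀ b ∈ bonds (bd p), W p ≤ wt b) (hwW : ∀ p ∈ Pl, ∀ b ∈ bonds (bd p), wt b ≤ Lc * W p)
    (hreg : ∀ p ∈ Pl, ‖(plaqWord (fun b : ↥Λ => U₀ b.1.1 b.1.2) (bd p) (0 : ↥Λ → 𝔸) : 𝔸) - 1‖ ≤ ε₀ * (η / W p) ^ 2)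
    (Y : WMax wt wd Dv) (hY : ‖Y‖ < ε / 2) (c : ↥Λ) :
    wt c ^ 3 * ‖locGrad (etaScale η (fun A : ↥Λ → 𝔸 =>
          ∑ p ∈ Pl, ord₃ (plaqFunSym τ (fun b : ↥Λ => U₀ b.1.1 b.1.2) (bd p)) A)) (WMax.toPiL wt wd Dv Y) c‖ ≤
      ‖Y‖ * ∑ b : ↥Λ,
        (72 * ((d : ℝ) - 1) * ‖τ‖ * Lc ^ 3 * (if b.1.1 ∈ nbhdSites c.1.1 c.1.2 then 1 else 0)
          + 8 * (‖τ‖ * (248 / 3 * ε₀ + 40 / 3 * ε)) * Lc ^ 4 *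
            ((Pl.filter (fun p => c ∈ bonds (bd p) ∧ b ∈ bonds (bd p))).card : ℝ)) * (wt b * ‖Y b‖) := by
  have h := located_quad_ord₃_eta_levels Λ Pl τ h₀ bd wt wd Dv Wf Wd W hη htr hincr hst hbd hor hLc hWd0 hWf hcf
    hcd hDv hε hε₀ hε4 hηW hWw hwW hreg Y hY c
  refine h.trans (le_of_eq ?_)
  congr 1
  rw [sum_filter_sum_eq_sum_card Pl (fun p => bonds (bd p)) c (fun b => wt b * ‖Y b‖), Finset.sum_filter,
    Finset.mul_sum, Finset.mul_sum, ← Finset.sum_add_distrib]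
  refine Finset.sum_congr rfl fun b _ => ?_
  split_ifs <;> ring

end Levels

end Summit.QuantumFields.BalabanUV.T4Continuum.ShellMeasurePlaquetteCubicLocated

end
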